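import Summits.NavierStokesRegularity.TurbBounds.Results.C200ModesB
import Summits.NavierStokesRegularity.TurbBounds.Certs.C200.ModeForm17
import Summits.NavierStokesRegularity.TurbBounds.Certs.C200.ModeForm18
import Summits.NavierStokesRegularity.TurbBounds.Certs.C200.ModeForm19
import Summits.NavierStokesRegularity.TurbBounds.Certs.C200.ModeForm20
import Summits.NavierStokesRegularity.TurbBounds.Certs.C200.ModeForm21
import Summits.NavierStokesRegularity.TurbBounds.Certs.C200.ModeForm22
import HarnessLib

/-!
# Row R-C200 (G1): wavenumbers 17–22, `PolyPositivityC200` DISCHARGED — the gate row from the cited reduction ALONE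
(cell `pub-turb` / `turb-bounds`, shear lane; v2, written by pub-turb-shear gen 7, 2026-08-22 (generator lean-t12/frame/twins/gen_c200.py). Lands after
`CouetteForm`, `Results/C200`, `CouettePolyBridge` and the Ca items `Certs/C200/ModeForm1…22` (gen 6).)

HONEST FRAMING: rigorous bounds for the stated PDE and boundary conditions; no claim about physical turbulence beyond the bound.
`polyPositivity_holds : Results.C200.PolyPositivityC200` (wavenumbers 17–22 here, 1–16 in `Results/C200ModesA/B.lean`). CONSEQUENCE:
`dissipation_bound_of_reduction (D) (hRed : Couette25Reduction 200 D) : D ≤ Scalars.B` and `ceps_bound_of_reduction : D/200 ≤ Scalars.Ceps ≤ 0.01348159626` (CERTIFIED.md row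
R-C200 = gate G1) from the ONE named hypothesis `Couette25Reduction` (RZG25, restricted to streamwise-invariant solutions — the label of record '2.5-D spectral constraint');
`couettePositivity_holds`: the streamwise-invariant spectral constraint of the certified pair for every integer k ≥ 1 on the two-sided C² × C¹ class, UNCONDITIONAL.
Everything else (22 LMI blocks, generator identities, two-field tail lemma, coupling split, cutoff k ≥ 23, density, profile arithmetic) is kernel-checked.
-/

set_option linter.style.longLine false

noncomputable section

namespace Summit.NavierStokesRegularity.TurbBounds.Results.C200

open Polynomial intervalIntegral MeasureTheory Set Finset Literature.Analysis.SpecialFunctions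
open Summit.NavierStokesRegularity.TurbBounds.LadderTail (w w_pos IsLadder)
open Summit.NavierStokesRegularity.TurbBounds.LegendreCoeffs
open Summit.NavierStokesRegularity.TurbBounds.TailPolyGenW (rbForm)
open Summit.NavierStokesRegularity.TurbBounds.TailTwoSided (TwoSidedX legCoeff_farWall_W legCoeff_farWall_Θ)
open Summit.NavierStokesRegularity.TurbBounds.CouetteForm
open Summit.NavierStokesRegularity.TurbBounds.CouettePolyBridge
open Summit.NavierStokesRegularity.TurbBounds.ShearPolyBridge (gpOf)
open Summit.NavierStokesRegularity.TurbBounds.ShearSpecPieces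
open Summit.NavierStokesRegularity.TurbBounds.ShearSpecPiecesTF
open Summit.NavierStokesRegularity.TurbBounds.Certs.C200

/-- **Wavenumber k = 17 of R-C200 (`N = 8`, `P = 12`) on two-sided polynomial pairs.** -/
theorem polyPositivity_mode17 (Wp Θp : ℝ[X]) (hW0 : Wp.eval (-1) = 0) (hW1 : (derivative Wp).eval (-1) = 0) (hW2 : Wp.eval 1 = 0)
    (hW3 : (derivative Wp).eval 1 = 0) (hΘ0 : Θp.eval (-1) = 0) (hΘ1 : Θp.eval 1 = 0) :
    0 ≤ rbForm (Scalars.c : ℝ) (Scalars.c : ℝ) (fun x => gC200.eval x) (((17 : ℕ) : ℝ) ^ 2) (fun x => Wp.eval x) (fun x => Θp.eval x) := by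
  set L := max (max Wp.natDegree Θp.natDegree) 12 + 1 with hL
  have hLW : Wp.natDegree < L := by omega
  have hLΘ : Θp.natDegree < L := by omega
  have hPL : 12 ≤ L := by omega
  have hghat : ∀ p, p < 12 + 1 → ModeForm.M17.ghat p = ghatC200 p := by
    intro p hp; unfold ModeForm.M17.ghat ghatC200; interval_cases p <;> rfl
  have hg : gC200 = gpOf 12 ModeForm.M17.ghat := by
    unfold gC200 gpOf; exact sum_congr rfl fun p hp => by rw [hghat p (mem_range.mp hp)]
  have hK : (((17 : ℕ) : ℝ) ^ 2) ≠ 0 := by positivity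
  have hKinv : (((1 / 289 : ℚ)) : ℝ) = 1 / (((17 : ℕ) : ℝ) ^ 2) := by norm_num
  have hK2 : (((289 : ℚ)) : ℝ) = (((17 : ℕ) : ℝ) ^ 2) := by norm_num
  rw [hg, rbForm_poly_decomp 8 12 Scalars.c (1 / 289) 289 hK hKinv hK2 ModeForm.M17.ghat Wp Θp hW0 hW1 hΘ0 L hLW hLΘ]
  obtain ⟨hc0, hc1⟩ := legCoeff_farWall_W Wp hW0 hW1 hW2 hW3
  have hd0 := legCoeff_farWall_Θ Θp hΘ0 hΘ1
  have hA : IsLadder (legCoeff (derivative (derivative Wp))) (legCoeff (derivative Wp)) := isLadder_legCoeff (derivative Wp) hW1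
  have h0a := legCoeff_zero_of_wall (derivative Wp) hW1
  have hB : IsLadder (legCoeff (derivative Wp)) (legCoeff Wp) := isLadder_legCoeff Wp hW0
  have h0b := legCoeff_zero_of_wall Wp hW0
  have hE : IsLadder (legCoeff (derivative Θp)) (legCoeff Θp) := isLadder_legCoeff Θp hΘ0
  have h0e := legCoeff_zero_of_wall Θp hΘ0
  have hT : ∀ x ∈ Icc (-1 : ℝ) 1, |(gpOf 12 ModeForm.M17.ghat).eval x| ≤ (Scalars.T : ℝ) := by
    rw [← hg]; exact gC200_abs_le
  have heps : (0 : ℝ) < ((Scalars.eps.getD 16 0 : ℚ) : ℝ) := by norm_num [Scalars.eps]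
  have hX := tailXTF_bound 8 12 ModeForm.M17.ghat Wp Θp hT L hLW hLΘ heps
  exact ModeForm.M17.modeForm_nonneg hA h0a hB h0b hc0 hc1 hE h0e hd0 L hPL hX

/-- **Wavenumber k = 18 of R-C200 (`N = 8`, `P = 12`) on two-sided polynomial pairs.** -/
theorem polyPositivity_mode18 (Wp Θp : ℝ[X]) (hW0 : Wp.eval (-1) = 0) (hW1 : (derivative Wp).eval (-1) = 0) (hW2 : Wp.eval 1 = 0)
    (hW3 : (derivative Wp).eval 1 = 0) (hΘ0 : Θp.eval (-1) = 0) (hΘ1 : Θp.eval 1 = 0) :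
    0 ≤ rbForm (Scalars.c : ℝ) (Scalars.c : ℝ) (fun x => gC200.eval x) (((18 : ℕ) : ℝ) ^ 2) (fun x => Wp.eval x) (fun x => Θp.eval x) := by
  set L := max (max Wp.natDegree Θp.natDegree) 12 + 1 with hL
  have hLW : Wp.natDegree < L := by omega
  have hLΘ : Θp.natDegree < L := by omega
  have hPL : 12 ≤ L := by omega
  have hghat : ∀ p, p < 12 + 1 → ModeForm.M18.ghat p = ghatC200 p := by
    intro p hp; unfold ModeForm.M18.ghat ghatC200; interval_cases p <;> rfl
  have hg : gC200 = gpOf 12 ModeForm.M18.ghat := by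
    unfold gC200 gpOf; exact sum_congr rfl fun p hp => by rw [hghat p (mem_range.mp hp)]
  have hK : (((18 : ℕ) : ℝ) ^ 2) ≠ 0 := by positivity
  have hKinv : (((1 / 324 : ℚ)) : ℝ) = 1 / (((18 : ℕ) : ℝ) ^ 2) := by norm_num
  have hK2 : (((324 : ℚ)) : ℝ) = (((18 : ℕ) : ℝ) ^ 2) := by norm_num
  rw [hg, rbForm_poly_decomp 8 12 Scalars.c (1 / 324) 324 hK hKinv hK2 ModeForm.M18.ghat Wp Θp hW0 hW1 hΘ0 L hLW hLΘ]
  obtain ⟨hc0, hc1⟩ := legCoeff_farWall_W Wp hW0 hW1 hW2 hW3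
  have hd0 := legCoeff_farWall_Θ Θp hΘ0 hΘ1
  have hA : IsLadder (legCoeff (derivative (derivative Wp))) (legCoeff (derivative Wp)) := isLadder_legCoeff (derivative Wp) hW1
  have h0a := legCoeff_zero_of_wall (derivative Wp) hW1
  have hB : IsLadder (legCoeff (derivative Wp)) (legCoeff Wp) := isLadder_legCoeff Wp hW0
  have h0b := legCoeff_zero_of_wall Wp hW0
  have hE : IsLadder (legCoeff (derivative Θp)) (legCoeff Θp) := isLadder_legCoeff Θp hΘ0
  have h0e := legCoeff_zero_of_wall Θp hΘ0
  have hT : ∀ x ∈ Icc (-1 : ℝ) 1, |(gpOf 12 ModeForm.M18.ghat).eval x| ≤ (Scalars.T : ℝ) := by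
    rw [← hg]; exact gC200_abs_le
  have heps : (0 : ℝ) < ((Scalars.eps.getD 17 0 : ℚ) : ℝ) := by norm_num [Scalars.eps]
  have hX := tailXTF_bound 8 12 ModeForm.M18.ghat Wp Θp hT L hLW hLΘ heps
  exact ModeForm.M18.modeForm_nonneg hA h0a hB h0b hc0 hc1 hE h0e hd0 L hPL hX

/-- **Wavenumber k = 19 of R-C200 (`N = 8`, `P = 12`) on two-sided polynomial pairs.** -/
theorem polyPositivity_mode19 (Wp Θp : ℝ[X]) (hW0 : Wp.eval (-1) = 0) (hW1 : (derivative Wp).eval (-1) = 0) (hW2 : Wp.eval 1 = 0)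
    (hW3 : (derivative Wp).eval 1 = 0) (hΘ0 : Θp.eval (-1) = 0) (hΘ1 : Θp.eval 1 = 0) :
    0 ≤ rbForm (Scalars.c : ℝ) (Scalars.c : ℝ) (fun x => gC200.eval x) (((19 : ℕ) : ℝ) ^ 2) (fun x => Wp.eval x) (fun x => Θp.eval x) := by
  set L := max (max Wp.natDegree Θp.natDegree) 12 + 1 with hL
  have hLW : Wp.natDegree < L := by omega
  have hLΘ : Θp.natDegree < L := by omega
  have hPL : 12 ≤ L := by omega
  have hghat : ∀ p, p < 12 + 1 → ModeForm.M19.ghat p = ghatC200 p := by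
    intro p hp; unfold ModeForm.M19.ghat ghatC200; interval_cases p <;> rfl
  have hg : gC200 = gpOf 12 ModeForm.M19.ghat := by
    unfold gC200 gpOf; exact sum_congr rfl fun p hp => by rw [hghat p (mem_range.mp hp)]
  have hK : (((19 : ℕ) : ℝ) ^ 2) ≠ 0 := by positivity
  have hKinv : (((1 / 361 : ℚ)) : ℝ) = 1 / (((19 : ℕ) : ℝ) ^ 2) := by norm_num
  have hK2 : (((361 : ℚ)) : ℝ) = (((19 : ℕ) : ℝ) ^ 2) := by norm_num
  rw [hg, rbForm_poly_decomp 8 12 Scalars.c (1 / 361) 361 hK hKinv hK2 ModeForm.M19.ghat Wp Θp hW0 hW1 hΘ0 L hLW hLΘ]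
  obtain ⟨hc0, hc1⟩ := legCoeff_farWall_W Wp hW0 hW1 hW2 hW3
  have hd0 := legCoeff_farWall_Θ Θp hΘ0 hΘ1
  have hA : IsLadder (legCoeff (derivative (derivative Wp))) (legCoeff (derivative Wp)) := isLadder_legCoeff (derivative Wp) hW1
  have h0a := legCoeff_zero_of_wall (derivative Wp) hW1
  have hB : IsLadder (legCoeff (derivative Wp)) (legCoeff Wp) := isLadder_legCoeff Wp hW0
  have h0b := legCoeff_zero_of_wall Wp hW0
  have hE : IsLadder (legCoeff (derivative Θp)) (legCoeff Θp) := isLadder_legCoeff Θp hΘ0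
  have h0e := legCoeff_zero_of_wall Θp hΘ0
  have hT : ∀ x ∈ Icc (-1 : ℝ) 1, |(gpOf 12 ModeForm.M19.ghat).eval x| ≤ (Scalars.T : ℝ) := by
    rw [← hg]; exact gC200_abs_le
  have heps : (0 : ℝ) < ((Scalars.eps.getD 18 0 : ℚ) : ℝ) := by norm_num [Scalars.eps]
  have hX := tailXTF_bound 8 12 ModeForm.M19.ghat Wp Θp hT L hLW hLΘ heps
  exact ModeForm.M19.modeForm_nonneg hA h0a hB h0b hc0 hc1 hE h0e hd0 L hPL hX

/-- **Wavenumber k = 20 of R-C200 (`N = 8`, `P = 12`) on two-sided polynomial pairs.** -/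
theorem polyPositivity_mode20 (Wp Θp : ℝ[X]) (hW0 : Wp.eval (-1) = 0) (hW1 : (derivative Wp).eval (-1) = 0) (hW2 : Wp.eval 1 = 0)
    (hW3 : (derivative Wp).eval 1 = 0) (hΘ0 : Θp.eval (-1) = 0) (hΘ1 : Θp.eval 1 = 0) :
    0 ≤ rbForm (Scalars.c : ℝ) (Scalars.c : ℝ) (fun x => gC200.eval x) (((20 : ℕ) : ℝ) ^ 2) (fun x => Wp.eval x) (fun x => Θp.eval x) := by
  set L := max (max Wp.natDegree Θp.natDegree) 12 + 1 with hL
  have hLW : Wp.natDegree < L := by omega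
  have hLΘ : Θp.natDegree < L := by omega
  have hPL : 12 ≤ L := by omega
  have hghat : ∀ p, p < 12 + 1 → ModeForm.M20.ghat p = ghatC200 p := by
    intro p hp; unfold ModeForm.M20.ghat ghatC200; interval_cases p <;> rfl
  have hg : gC200 = gpOf 12 ModeForm.M20.ghat := by
    unfold gC200 gpOf; exact sum_congr rfl fun p hp => by rw [hghat p (mem_range.mp hp)]
  have hK : (((20 : ℕ) : ℝ) ^ 2) ≠ 0 := by positivity
  have hKinv : (((1 / 400 : ℚ)) : ℝ) = 1 / (((20 : ℕ) : ℝ) ^ 2) := by norm_num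
  have hK2 : (((400 : ℚ)) : ℝ) = (((20 : ℕ) : ℝ) ^ 2) := by norm_num
  rw [hg, rbForm_poly_decomp 8 12 Scalars.c (1 / 400) 400 hK hKinv hK2 ModeForm.M20.ghat Wp Θp hW0 hW1 hΘ0 L hLW hLΘ]
  obtain ⟨hc0, hc1⟩ := legCoeff_farWall_W Wp hW0 hW1 hW2 hW3
  have hd0 := legCoeff_farWall_Θ Θp hΘ0 hΘ1
  have hA : IsLadder (legCoeff (derivative (derivative Wp))) (legCoeff (derivative Wp)) := isLadder_legCoeff (derivative Wp) hW1
  have h0a := legCoeff_zero_of_wall (derivative Wp) hW1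
  have hB : IsLadder (legCoeff (derivative Wp)) (legCoeff Wp) := isLadder_legCoeff Wp hW0
  have h0b := legCoeff_zero_of_wall Wp hW0
  have hE : IsLadder (legCoeff (derivative Θp)) (legCoeff Θp) := isLadder_legCoeff Θp hΘ0
  have h0e := legCoeff_zero_of_wall Θp hΘ0
  have hT : ∀ x ∈ Icc (-1 : ℝ) 1, |(gpOf 12 ModeForm.M20.ghat).eval x| ≤ (Scalars.T : ℝ) := by
    rw [← hg]; exact gC200_abs_le
  have heps : (0 : ℝ) < ((Scalars.eps.getD 19 0 : ℚ) : ℝ) := by norm_num [Scalars.eps]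
  have hX := tailXTF_bound 8 12 ModeForm.M20.ghat Wp Θp hT L hLW hLΘ heps
  exact ModeForm.M20.modeForm_nonneg hA h0a hB h0b hc0 hc1 hE h0e hd0 L hPL hX

/-- **Wavenumber k = 21 of R-C200 (`N = 8`, `P = 12`) on two-sided polynomial pairs.** -/
theorem polyPositivity_mode21 (Wp Θp : ℝ[X]) (hW0 : Wp.eval (-1) = 0) (hW1 : (derivative Wp).eval (-1) = 0) (hW2 : Wp.eval 1 = 0)
    (hW3 : (derivative Wp).eval 1 = 0) (hΘ0 : Θp.eval (-1) = 0) (hΘ1 : Θp.eval 1 = 0) :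
    0 ≤ rbForm (Scalars.c : ℝ) (Scalars.c : ℝ) (fun x => gC200.eval x) (((21 : ℕ) : ℝ) ^ 2) (fun x => Wp.eval x) (fun x => Θp.eval x) := by
  set L := max (max Wp.natDegree Θp.natDegree) 12 + 1 with hL
  have hLW : Wp.natDegree < L := by omega
  have hLΘ : Θp.natDegree < L := by omega
  have hPL : 12 ≤ L := by omega
  have hghat : ∀ p, p < 12 + 1 → ModeForm.M21.ghat p = ghatC200 p := by
    intro p hp; unfold ModeForm.M21.ghat ghatC200; interval_cases p <;> rfl
  have hg : gC200 = gpOf 12 ModeForm.M21.ghat := by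
    unfold gC200 gpOf; exact sum_congr rfl fun p hp => by rw [hghat p (mem_range.mp hp)]
  have hK : (((21 : ℕ) : ℝ) ^ 2) ≠ 0 := by positivity
  have hKinv : (((1 / 441 : ℚ)) : ℝ) = 1 / (((21 : ℕ) : ℝ) ^ 2) := by norm_num
  have hK2 : (((441 : ℚ)) : ℝ) = (((21 : ℕ) : ℝ) ^ 2) := by norm_num
  rw [hg, rbForm_poly_decomp 8 12 Scalars.c (1 / 441) 441 hK hKinv hK2 ModeForm.M21.ghat Wp Θp hW0 hW1 hΘ0 L hLW hLΘ]
  obtain ⟨hc0, hc1⟩ := legCoeff_farWall_W Wp hW0 hW1 hW2 hW3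
  have hd0 := legCoeff_farWall_Θ Θp hΘ0 hΘ1
  have hA : IsLadder (legCoeff (derivative (derivative Wp))) (legCoeff (derivative Wp)) := isLadder_legCoeff (derivative Wp) hW1
  have h0a := legCoeff_zero_of_wall (derivative Wp) hW1
  have hB : IsLadder (legCoeff (derivative Wp)) (legCoeff Wp) := isLadder_legCoeff Wp hW0
  have h0b := legCoeff_zero_of_wall Wp hW0
  have hE : IsLadder (legCoeff (derivative Θp)) (legCoeff Θp) := isLadder_legCoeff Θp hΘ0
  have h0e := legCoeff_zero_of_wall Θp hΘ0
  have hT : ∀ x ∈ Icc (-1 : ℝ) 1, |(gpOf 12 ModeForm.M21.ghat).eval x| ≤ (Scalars.T : ℝ) := by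
    rw [← hg]; exact gC200_abs_le
  have heps : (0 : ℝ) < ((Scalars.eps.getD 20 0 : ℚ) : ℝ) := by norm_num [Scalars.eps]
  have hX := tailXTF_bound 8 12 ModeForm.M21.ghat Wp Θp hT L hLW hLΘ heps
  exact ModeForm.M21.modeForm_nonneg hA h0a hB h0b hc0 hc1 hE h0e hd0 L hPL hX

/-- **Wavenumber k = 22 of R-C200 (`N = 8`, `P = 12`) on two-sided polynomial pairs.** -/
theorem polyPositivity_mode22 (Wp Θp : ℝ[X]) (hW0 : Wp.eval (-1) = 0) (hW1 : (derivative Wp).eval (-1) = 0) (hW2 : Wp.eval 1 = 0)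
    (hW3 : (derivative Wp).eval 1 = 0) (hΘ0 : Θp.eval (-1) = 0) (hΘ1 : Θp.eval 1 = 0) :
    0 ≤ rbForm (Scalars.c : ℝ) (Scalars.c : ℝ) (fun x => gC200.eval x) (((22 : ℕ) : ℝ) ^ 2) (fun x => Wp.eval x) (fun x => Θp.eval x) := by
  set L := max (max Wp.natDegree Θp.natDegree) 12 + 1 with hL
  have hLW : Wp.natDegree < L := by omega
  have hLΘ : Θp.natDegree < L := by omega
  have hPL : 12 ≤ L := by omega
  have hghat : ∀ p, p < 12 + 1 → ModeForm.M22.ghat p = ghatC200 p := by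
    intro p hp; unfold ModeForm.M22.ghat ghatC200; interval_cases p <;> rfl
  have hg : gC200 = gpOf 12 ModeForm.M22.ghat := by
    unfold gC200 gpOf; exact sum_congr rfl fun p hp => by rw [hghat p (mem_range.mp hp)]
  have hK : (((22 : ℕ) : ℝ) ^ 2) ≠ 0 := by positivity
  have hKinv : (((1 / 484 : ℚ)) : ℝ) = 1 / (((22 : ℕ) : ℝ) ^ 2) := by norm_num
  have hK2 : (((484 : ℚ)) : ℝ) = (((22 : ℕ) : ℝ) ^ 2) := by norm_num
  rw [hg, rbForm_poly_decomp 8 12 Scalars.c (1 / 484) 484 hK hKinv hK2 ModeForm.M22.ghat Wp Θp hW0 hW1 hΘ0 L hLW hLΘ]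
  obtain ⟨hc0, hc1⟩ := legCoeff_farWall_W Wp hW0 hW1 hW2 hW3
  have hd0 := legCoeff_farWall_Θ Θp hΘ0 hΘ1
  have hA : IsLadder (legCoeff (derivative (derivative Wp))) (legCoeff (derivative Wp)) := isLadder_legCoeff (derivative Wp) hW1
  have h0a := legCoeff_zero_of_wall (derivative Wp) hW1
  have hB : IsLadder (legCoeff (derivative Wp)) (legCoeff Wp) := isLadder_legCoeff Wp hW0
  have h0b := legCoeff_zero_of_wall Wp hW0
  have hE : IsLadder (legCoeff (derivative Θp)) (legCoeff Θp) := isLadder_legCoeff Θp hΘ0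
  have h0e := legCoeff_zero_of_wall Θp hΘ0
  have hT : ∀ x ∈ Icc (-1 : ℝ) 1, |(gpOf 12 ModeForm.M22.ghat).eval x| ≤ (Scalars.T : ℝ) := by
    rw [← hg]; exact gC200_abs_le
  have heps : (0 : ℝ) < ((Scalars.eps.getD 21 0 : ℚ) : ℝ) := by norm_num [Scalars.eps]
  have hX := tailXTF_bound 8 12 ModeForm.M22.ghat Wp Θp hT L hLW hLΘ heps
  exact ModeForm.M22.modeForm_nonneg hA h0a hB h0b hc0 hc1 hE h0e hd0 L hPL hX

/-- **`PolyPositivityC200`, PROVED.** -/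
theorem polyPositivity_holds : PolyPositivityC200 := by
  intro k hk hle Wp Θp hW0 hW1 hW2 hW3 hΘ0 hΘ1
  have hle' : k ≤ 22 := by simpa [Scalars.mCert] using hle
  interval_cases k
  · exact polyPositivity_mode1 Wp Θp hW0 hW1 hW2 hW3 hΘ0 hΘ1
  · exact polyPositivity_mode2 Wp Θp hW0 hW1 hW2 hW3 hΘ0 hΘ1
  · exact polyPositivity_mode3 Wp Θp hW0 hW1 hW2 hW3 hΘ0 hΘ1
  · exact polyPositivity_mode4 Wp Θp hW0 hW1 hW2 hW3 hΘ0 hΘ1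
  · exact polyPositivity_mode5 Wp Θp hW0 hW1 hW2 hW3 hΘ0 hΘ1
  · exact polyPositivity_mode6 Wp Θp hW0 hW1 hW2 hW3 hΘ0 hΘ1
  · exact polyPositivity_mode7 Wp Θp hW0 hW1 hW2 hW3 hΘ0 hΘ1
  · exact polyPositivity_mode8 Wp Θp hW0 hW1 hW2 hW3 hΘ0 hΘ1
  · exact polyPositivity_mode9 Wp Θp hW0 hW1 hW2 hW3 hΘ0 hΘ1
  · exact polyPositivity_mode10 Wp Θp hW0 hW1 hW2 hW3 hΘ0 hΘ1
  · exact polyPositivity_mode11 Wp Θp hW0 hW1 hW2 hW3 hΘ0 hΘ1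
  · exact polyPositivity_mode12 Wp Θp hW0 hW1 hW2 hW3 hΘ0 hΘ1
  · exact polyPositivity_mode13 Wp Θp hW0 hW1 hW2 hW3 hΘ0 hΘ1
  · exact polyPositivity_mode14 Wp Θp hW0 hW1 hW2 hW3 hΘ0 hΘ1
  · exact polyPositivity_mode15 Wp Θp hW0 hW1 hW2 hW3 hΘ0 hΘ1
  · exact polyPositivity_mode16 Wp Θp hW0 hW1 hW2 hW3 hΘ0 hΘ1
  · exact polyPositivity_mode17 Wp Θp hW0 hW1 hW2 hW3 hΘ0 hΘ1
  · exact polyPositivity_mode18 Wp Θp hW0 hW1 hW2 hW3 hΘ0 hΘ1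
  · exact polyPositivity_mode19 Wp Θp hW0 hW1 hW2 hW3 hΘ0 hΘ1
  · exact polyPositivity_mode20 Wp Θp hW0 hW1 hW2 hW3 hΘ0 hΘ1
  · exact polyPositivity_mode21 Wp Θp hW0 hW1 hW2 hW3 hΘ0 hΘ1
  · exact polyPositivity_mode22 Wp Θp hW0 hW1 hW2 hW3 hΘ0 hΘ1

/-! ## Row R-C200 from the cited reduction alone -/

/-- The streamwise-invariant spectral constraint of the certified Couette pair holds for EVERY integer `k ≥ 1` on the two-sided class — UNCONDITIONAL. -/
theorem couettePositivity_holds : CouettePositivity (Scalars.c : ℝ) (fun x => gC200.eval x) :=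
  couettePositivity_of_polyPositivity polyPositivity_holds

/-- **Row R-C200 (G1), from ONE named hypothesis**: `Couette25Reduction 200 D → D ≤ B` (`B = Scalars.B ≤ 2.696319252`). -/
theorem dissipation_bound_of_reduction (D : ℝ) (hRed : Couette25Reduction (200 : ℝ) D) : D ≤ (Scalars.B : ℝ) :=
  dissipation_bound D hRed polyPositivity_holds

/-- **Row R-C200 (G1), dissipation coefficient, from ONE named hypothesis**: `Couette25Reduction 200 D → D/200 ≤ Scalars.Ceps`. -/
theorem ceps_bound_of_reduction (D : ℝ) (hRed : Couette25Reduction (200 : ℝ) D) : D / 200 ≤ (Scalars.Ceps : ℝ) :=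
  ceps_bound D hRed polyPositivity_holds

/-- … with the outward decimal of CERTIFIED.md row R-C200: `C_ε ≤ 0.01348159626`. -/
theorem ceps_bound_decimal_of_reduction (D : ℝ) (hRed : Couette25Reduction (200 : ℝ) D) : D / 200 ≤ (674079813 : ℝ) / 50000000000 :=
  ceps_bound_decimal D hRed polyPositivity_holds

/-- Vacuity guard, now unconditional: the hypothesis is not provable for every `D` (`D = 3 > B` fails). -/
theorem couette25Reduction_nontrivial_holds : ¬ Couette25Reduction (200 : ℝ) 3 :=
  couette25Reduction_nontrivial polyPositivity_holds

end Summit.NavierStokesRegularity.TurbBounds.Results.C200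

end
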